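/-
Copyright (c) 2026. All rights reserved.
Released under Apache 2.0 license as described in the file LICENSE.
-/
import Literature.NumberTheory.ComplexMultiplication.CMTypeCountingFormulas
import Literature.NumberTheory.ComplexMultiplication.CMTypeRank
import HarnessLib

/-!
# Dictionary: the tree's CM types `IsCMTypeWith ρ T` on a finite commutative group are Kida's half-systems —
# there are `2^{|G|/2}` of them

Two vocabularies of the tree describe the same objects on a finite COMMUTATIVE group `G` with an involution `ρ`:
the orbit-theoretic `IsCMTypeWith ρ (T : Set G)` of `CMTypeRank` (G. Shimura [Shimura1998] §18.1: `x ∈ T ⟺ ρx ∉ T`,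
`ρ` commuting with the action, `ρ² = 1`; the vocabulary of Kubota's rank formula, `CMTypeRankCharacters`, and of the
`DegenerateCMTypes…` files) and the counting vocabulary `CMTypeCounting.IsHalfSystem ρ T` / `halfSystems ρ` of
`CMTypeCountingFormulas` (M. Kida [Kida2019CountingCMTypes] §1: «a half set», with `|halfSystems ρ| = 2^{|G|/2}`,
tree `card_halfSystems`, Kida's Prop. 3.1 / Lemma 2.3).  THIS FILE is the one-line dictionary and the transported
count, so that the census files (`DegenerateCMTypesElementaryAbelianRankFiveCensus`, …) can be read against the
total number of CM types:

> **Theorem** (`isCMTypeWith_coe_iff_isHalfSystem`).  For `ρ² = 1` on a commutative group: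
> `IsCMTypeWith ρ ↑T ↔ IsHalfSystem ρ T`; hence (`filter_isCMTypeWith_eq_halfSystems`) the finset of CM types IS
> `halfSystems ρ`, and (**`card_filter_isCMTypeWith`**, `ncard_setOf_isCMTypeWith`) **a finite commutative group with
> an involution `ρ ≠ 1` carries exactly `2^{|G|/2}` CM types** — `16`, `256`, `65536` in orders `8`, `16`, `32`
> (`card_filter_isCMTypeWith_of_card_eq_eight / sixteen / thirtyTwo`); on the field side this is the tree's
> `CMTypeCount.natCard_cmType` (`2^{[K:ℚ]/2}` CM types, K. A. Ribet [Ribet1980] §3 (3.1)).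

* `rho_mul_self_of_isCMTypeWith` (a CM type forces `ρ² = 1`), **`isCMTypeWith_coe_iff_isHalfSystem`**,
  `filter_isCMTypeWith_eq_halfSystems`, **`card_filter_isCMTypeWith`**, `ncard_setOf_isCMTypeWith`,
  `card_filter_isCMTypeWith_of_sq_eq_one` (exponent `2`), `…_of_card_eq_eight / sixteen / thirtyTwo`.
* (row g40-#14) STABILISED TYPES: `filter_isCMTypeWith_stable_eq_cmTypes` (the CM types with `N ≤ Stab(T)` are
  Kida's `cmTypes ρ N`), **`card_filter_isCMTypeWith_stable`** (`2^{[G:N]/2}` of them for `ρ ∉ N` — the types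
  induced from `G/N`; Kida's `|CM(G,H,ρ)| = 2^{½(G:H)}`, tree `card_cmTypes`), `…_stable_eq_zero` (`ρ ∈ N`),
  `card_filter_isCMTypeWith_forall_mul_mem_iff` (one stabilising element), `…_of_sq_eq_one` (exponent `2`:
  `2^{|G|/4}` types stabilised by a given `n ∉ {1, ρ}`).

HONEST SCOPE.  Pure dictionary; the count is Kida's (tree-proved).  THEOREMS ONLY: no definition, no named fact, no
instance, no `sorry`.

## References

* [Kida2019CountingCMTypes] M. Kida, *Counting formulas for CM-types*, Moscow J. Combin. Number Theory 8 (2019),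
  §1 (half sets), Lemma 2.3, Prop. 3.1.
* [Shimura1998] G. Shimura, *Abelian Varieties with Complex Multiplication and Modular Functions*, §18.1.
* [Ribet1980] K. A. Ribet, *Division fields of abelian varieties with complex multiplication*, Mém. SMF 2 (1980),
  §3 (3.1).

## Provenance

Lane `lit-hodgefound` (Track 2, Layer A3), seat `lit-hodgefound-p10` generation 40, row g40-#13; neighbours cited by
name: `CMTypeCountingFormulas` (`IsHalfSystem`, `halfSystems`, `mem_halfSystems`, `card_halfSystems`), `CMTypeRank`
(`IsCMTypeWith`).
-/

open scoped Classical

namespace Literature.NumberTheory.ComplexMultiplication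

namespace CMTypeCounting

variable {G : Type*} [CommGroup G] {ρ : G} {T : Finset G}

/-- A CM type in the tree's sense forces `ρ² = 1`. [cite: Shimura1998, §18.1] -/
theorem rho_mul_self_of_isCMTypeWith (h : IsCMTypeWith ρ (T : Set G)) : ρ * ρ = 1 := by
  have := h.invol (1 : G)
  simpa [smul_eq_mul] using this

/-- **DICTIONARY: `IsCMTypeWith ρ ↑T ↔ IsHalfSystem ρ T`** on a commutative group with `ρ² = 1` (the commutation
and involution clauses of `IsCMTypeWith` are automatic). [cite: Shimura1998, §18.1]
[cite: Kida2019CountingCMTypes, §1] -/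
theorem isCMTypeWith_coe_iff_isHalfSystem (hρ2 : ρ * ρ = 1) :
    IsCMTypeWith ρ (T : Set G) ↔ IsHalfSystem ρ T := by
  constructor
  · intro h x
    have := h.mem_iff x
    simpa only [Finset.mem_coe, smul_eq_mul] using this
  · intro h
    exact ⟨fun x => by simpa only [Finset.mem_coe, smul_eq_mul] using h x,
      fun g x => by simp only [smul_eq_mul]; rw [mul_left_comm],
      fun x => by simp only [smul_eq_mul]; rw [← mul_assoc, hρ2, one_mul]⟩

/-- Without the hypothesis: `IsCMTypeWith ρ ↑T ↔ IsHalfSystem ρ T ∧ ρ² = 1`. [cite: Shimura1998, §18.1]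
[cite: Kida2019CountingCMTypes, §1] -/
theorem isCMTypeWith_coe_iff_isHalfSystem_and :
    IsCMTypeWith ρ (T : Set G) ↔ IsHalfSystem ρ T ∧ ρ * ρ = 1 :=
  ⟨fun h => ⟨(isCMTypeWith_coe_iff_isHalfSystem (rho_mul_self_of_isCMTypeWith h)).1 h,
    rho_mul_self_of_isCMTypeWith h⟩, fun h => (isCMTypeWith_coe_iff_isHalfSystem h.2).2 h.1⟩

variable [Fintype G]

/-- **The finset of CM types of `(G, ρ)` is Kida's `halfSystems ρ`.** [cite: Kida2019CountingCMTypes, §1] -/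
theorem filter_isCMTypeWith_eq_halfSystems (hρ2 : ρ * ρ = 1) :
    ((Finset.univ : Finset (Finset G)).filter fun T : Finset G => IsCMTypeWith ρ (T : Set G)) = halfSystems ρ := by
  ext T
  simp only [Finset.mem_filter, Finset.mem_univ, true_and, mem_halfSystems]
  exact isCMTypeWith_coe_iff_isHalfSystem hρ2

/-- **A FINITE COMMUTATIVE GROUP WITH AN INVOLUTION `ρ ≠ 1` CARRIES EXACTLY `2^{|G|/2}` CM TYPES** (Kida's count of
half-systems, tree `card_halfSystems`). [cite: Kida2019CountingCMTypes, Lemma 2.3 and Prop. 3.1]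
[cite: Ribet1980, §3 (3.1)] -/
theorem card_filter_isCMTypeWith (hρ1 : ρ ≠ 1) (hρ2 : ρ * ρ = 1) :
    ((Finset.univ : Finset (Finset G)).filter fun T : Finset G => IsCMTypeWith ρ (T : Set G)).card =
      2 ^ (Fintype.card G / 2) := by
  rw [filter_isCMTypeWith_eq_halfSystems hρ2]
  exact card_halfSystems (fun g => mul_comm g ρ) hρ2 hρ1

/-- The same count in `Set.ncard` form (the shape of the tree's `ncard_cmTypes` lemmas for cyclic and elementary
abelian frames). [cite: Kida2019CountingCMTypes, Lemma 2.3 and Prop. 3.1] -/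
theorem ncard_setOf_isCMTypeWith (hρ1 : ρ ≠ 1) (hρ2 : ρ * ρ = 1) :
    {T : Finset G | IsCMTypeWith ρ (T : Set G)}.ncard = 2 ^ (Fintype.card G / 2) := by
  rw [show {T : Finset G | IsCMTypeWith ρ (T : Set G)} =
      ↑((Finset.univ : Finset (Finset G)).filter fun T : Finset G => IsCMTypeWith ρ (T : Set G)) by ext T; simp,
    Set.ncard_coe_finset, card_filter_isCMTypeWith hρ1 hρ2]

/-- **Exponent `2`**: `2^{|G|/2}` CM types w.r.t. any `ρ ≠ 1` (the multiquadratic CM fields).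
[cite: Kida2019CountingCMTypes, Lemma 2.3] [cite: Ribet1980, §3 (3.1)] -/
theorem card_filter_isCMTypeWith_of_sq_eq_one (hexp : ∀ g : G, g ^ 2 = 1) (hρ1 : ρ ≠ 1) :
    ((Finset.univ : Finset (Finset G)).filter fun T : Finset G => IsCMTypeWith ρ (T : Set G)).card =
      2 ^ (Fintype.card G / 2) :=
  card_filter_isCMTypeWith hρ1 (by rw [← pow_two]; exact hexp ρ)

/-- Order `8`, exponent `2`: `16` CM types. [cite: Kida2019CountingCMTypes, Lemma 2.3] -/
theorem card_filter_isCMTypeWith_of_card_eq_eight (hexp : ∀ g : G, g ^ 2 = 1) (hρ1 : ρ ≠ 1)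
    (h8 : Fintype.card G = 8) :
    ((Finset.univ : Finset (Finset G)).filter fun T : Finset G => IsCMTypeWith ρ (T : Set G)).card = 16 := by
  rw [card_filter_isCMTypeWith_of_sq_eq_one hexp hρ1, h8]; norm_num

/-- Order `16`, exponent `2`: `256` CM types. [cite: Kida2019CountingCMTypes, Lemma 2.3] -/
theorem card_filter_isCMTypeWith_of_card_eq_sixteen (hexp : ∀ g : G, g ^ 2 = 1) (hρ1 : ρ ≠ 1)
    (h16 : Fintype.card G = 16) :
    ((Finset.univ : Finset (Finset G)).filter fun T : Finset G => IsCMTypeWith ρ (T : Set G)).card = 256 := by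
  rw [card_filter_isCMTypeWith_of_sq_eq_one hexp hρ1, h16]; norm_num

/-- Order `32`, exponent `2`: `65536` CM types. [cite: Kida2019CountingCMTypes, Lemma 2.3] -/
theorem card_filter_isCMTypeWith_of_card_eq_thirtyTwo (hexp : ∀ g : G, g ^ 2 = 1) (hρ1 : ρ ≠ 1)
    (h32 : Fintype.card G = 32) :
    ((Finset.univ : Finset (Finset G)).filter fun T : Finset G => IsCMTypeWith ρ (T : Set G)).card = 65536 := by
  rw [card_filter_isCMTypeWith_of_sq_eq_one hexp hρ1, h32]; norm_num

/-! ## Types stabilised by a subgroup: `2^{[G:N]/2}` of them (the CM types of the subfield `L^N`) -/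

omit [Fintype G] in
/-- Stability under one element propagates to its integer powers. [folklore] -/
private theorem forall_mul_zpow_mem_iff {n : G} (hn : ∀ t : G, t * n ∈ T ↔ t ∈ T) (k : ℤ) (t : G) :
    t * n ^ k ∈ T ↔ t ∈ T := by
  have hinv : ∀ t : G, t * n⁻¹ ∈ T ↔ t ∈ T := fun t => by
    rw [← hn (t * n⁻¹), inv_mul_cancel_right]
  induction k using Int.induction_on generalizing t with
  | zero => rw [zpow_zero, mul_one]
  | succ k ih =>
    rw [zpow_add_one, ← mul_assoc]
    exact (hn _).trans (ih _)
  | pred k ih =>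
    rw [zpow_sub_one, ← mul_assoc]
    exact (hinv _).trans (ih _)

omit [Fintype G] in
/-- Stability under one element propagates to its cyclic subgroup. [folklore] -/
private theorem forall_mul_mem_iff_of_mem_zpowers {n : G} (hn : ∀ t : G, t * n ∈ T ↔ t ∈ T) {g : G}
    (hg : g ∈ Subgroup.zpowers n) (t : G) : t * g ∈ T ↔ t ∈ T := by
  obtain ⟨k, rfl⟩ := Subgroup.mem_zpowers_iff.1 hg
  exact forall_mul_zpow_mem_iff hn k t

/-- **DICTIONARY FOR STABILISED TYPES**: the CM types `T` with `N ≤ Stab(T)` (`tn ∈ T ⟺ t ∈ T` for `n ∈ N`) are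
Kida's `cmTypes ρ N` — the CM types of `(G, N, ρ)`, i.e. of the subfield `L^N`. [cite: Kida2019CountingCMTypes, §1] -/
theorem filter_isCMTypeWith_stable_eq_cmTypes (hρ2 : ρ * ρ = 1) (N : Subgroup G) :
    ((Finset.univ : Finset (Finset G)).filter fun T : Finset G =>
      IsCMTypeWith ρ (T : Set G) ∧ ∀ n ∈ N, ∀ t : G, t * n ∈ T ↔ t ∈ T) = cmTypes ρ N := by
  ext T
  simp only [Finset.mem_filter, Finset.mem_univ, true_and, mem_cmTypes, isCMTypeWith_coe_iff_isHalfSystem hρ2]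
  exact and_congr_right fun _ =>
    ⟨fun h n hn => mem_rightStab_iff.2 (h n hn), fun h n hn => mem_rightStab_iff.1 (h hn)⟩

/-- **A FINITE COMMUTATIVE GROUP CARRIES EXACTLY `2^{[G:N]/2}` CM TYPES STABILISED BY A SUBGROUP `N ∌ ρ`** (the
CM types induced from `G/N`: on the field side, the `2^{[L^N:ℚ]/2}` CM types of the CM subfield `L^N` lifted to
`L`), and none if `ρ ∈ N` (Kida's `|CM(G, H, ρ)| = 2^{½(G:H)}`, tree `card_cmTypes`).
[cite: Kida2019CountingCMTypes, Lemma 2.3] [cite: Ribet1980, §3 (3.1)] -/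
theorem card_filter_isCMTypeWith_stable (hρ2 : ρ * ρ = 1) (N : Subgroup G) (hρN : ρ ∉ N) :
    ((Finset.univ : Finset (Finset G)).filter fun T : Finset G =>
      IsCMTypeWith ρ (T : Set G) ∧ ∀ n ∈ N, ∀ t : G, t * n ∈ T ↔ t ∈ T).card = 2 ^ (N.index / 2) := by
  rw [filter_isCMTypeWith_stable_eq_cmTypes hρ2 N, card_cmTypes (fun g => mul_comm g ρ) hρ2 N, if_neg hρN]

/-- No CM type is stabilised by a subgroup containing `ρ`. [cite: Kida2019CountingCMTypes, §1] -/
theorem card_filter_isCMTypeWith_stable_eq_zero (hρ2 : ρ * ρ = 1) (N : Subgroup G) (hρN : ρ ∈ N) :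
    ((Finset.univ : Finset (Finset G)).filter fun T : Finset G =>
      IsCMTypeWith ρ (T : Set G) ∧ ∀ n ∈ N, ∀ t : G, t * n ∈ T ↔ t ∈ T).card = 0 := by
  rw [filter_isCMTypeWith_stable_eq_cmTypes hρ2 N, card_cmTypes (fun g => mul_comm g ρ) hρ2 N, if_pos hρN]

/-- **Stabilised by one element `n`**: `2^{[G:⟨n⟩]/2}` CM types have `tn ∈ T ⟺ t ∈ T` for all `t`, provided
`ρ ∉ ⟨n⟩` (stability under `n` is stability under `⟨n⟩`). [cite: Kida2019CountingCMTypes, Lemma 2.3] -/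
theorem card_filter_isCMTypeWith_forall_mul_mem_iff (hρ2 : ρ * ρ = 1) {n : G} (hρn : ρ ∉ Subgroup.zpowers n) :
    ((Finset.univ : Finset (Finset G)).filter fun T : Finset G =>
      IsCMTypeWith ρ (T : Set G) ∧ ∀ t : G, t * n ∈ T ↔ t ∈ T).card = 2 ^ ((Subgroup.zpowers n).index / 2) := by
  rw [← card_filter_isCMTypeWith_stable hρ2 (Subgroup.zpowers n) hρn]
  congr 1
  refine Finset.filter_congr fun T _ => and_congr_right fun _ => ?_
  exact ⟨fun h g hg t => forall_mul_mem_iff_of_mem_zpowers h hg t,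
    fun h t => h n (Subgroup.mem_zpowers n) t⟩

/-- **Exponent `2`, `ρ ≠ 1`, one stabilising element `n ∉ {1, ρ}`: `2^{|G|/4}` CM types** (the types of a
multiquadratic CM field of degree `2g` lifted from a given CM subfield of degree `g`: `2^{g/2}` of the `2^g`).
[cite: Kida2019CountingCMTypes, Lemma 2.3] [cite: Ribet1980, §3 (3.1)] -/
theorem card_filter_isCMTypeWith_forall_mul_mem_iff_of_sq_eq_one (hexp : ∀ g : G, g ^ 2 = 1) (hρ1 : ρ ≠ 1)
    {n : G} (hn1 : n ≠ 1) (hnρ : n ≠ ρ) :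
    ((Finset.univ : Finset (Finset G)).filter fun T : Finset G =>
      IsCMTypeWith ρ (T : Set G) ∧ ∀ t : G, t * n ∈ T ↔ t ∈ T).card = 2 ^ (Fintype.card G / 4) := by
  have hρ2 : ρ * ρ = 1 := by rw [← pow_two]; exact hexp ρ
  have hn2 : n * n = 1 := by rw [← pow_two]; exact hexp n
  -- `⟨n⟩ = {1, n}` has order `2`
  have horder : orderOf n = 2 := orderOf_eq_prime (by rw [pow_two, hn2]) hn1
  have hcard : Nat.card (Subgroup.zpowers n) = 2 := by rw [Nat.card_zpowers, horder]
  have hρn : ρ ∉ Subgroup.zpowers n := by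
    intro h
    obtain ⟨k, hk⟩ := Subgroup.mem_zpowers_iff.1 h
    -- `n ^ k ∈ {1, n}`
    have hmem : n ^ k = 1 ∨ n ^ k = n := by
      rcases Int.even_or_odd k with ⟨j, rfl⟩ | ⟨j, rfl⟩
      · left
        rw [← two_mul, zpow_mul, zpow_ofNat, pow_two, hn2, one_zpow]
      · right
        rw [zpow_add, zpow_mul, zpow_ofNat, pow_two, hn2, one_zpow, one_mul, zpow_one]
    rcases hmem with h1 | h1
    · rw [h1] at hk
      exact hρ1 hk.symm
    · rw [h1] at hk
      exact hnρ hk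
  have hindex : (Subgroup.zpowers n).index = Fintype.card G / 2 := by
    have h := (Subgroup.zpowers n).card_mul_index
    rw [hcard, Nat.card_eq_fintype_card] at h
    omega
  rw [card_filter_isCMTypeWith_forall_mul_mem_iff hρ2 hρn, hindex, Nat.div_div_eq_div_mul]

end CMTypeCounting

end Literature.NumberTheory.ComplexMultiplication
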